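import Literature.RingTheory.FittingIdeal.Basic
import Mathlib.LinearAlgebra.Matrix.Determinant.Basic
import HarnessLib

/-!
# Fitting ideals increase with the index (Stacks, Tag 07ZA; Eisenbud §20.2)

Topic: `Literature/RingTheory/FittingIdeal`. The chain property of the Fitting ideals
(`Literature.RingTheory.FittingIdeal.Module.fittingIdeal`, `Basic.lean`): "`0 = Fitt_{-1}(M) ⊆
Fitt₀(M) ⊆ Fitt₁(M) ⊆ … ⊆ Fitt_n(M) = R`" (Eisenbud, *Commutative Algebra*, §20.2, after the
definition; The Stacks Project, Tag 07ZA (2): "`Fitt_{k-1}(M) ⊆ Fitt_k(M)`"), by Laplace expansion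
of a `j × j` minor along its first row into `(j - 1) × (j - 1)` minors of the same relation
matrix (Mathlib `Matrix.det_succ_row_zero`). All proved:

* `Module.fittingIdeal_eq_top_of_span_eq_top_of_le` — `Fitt_k(M) = R` as soon as `M` is
  generated by `≤ k` elements (padding a generating family with zeros);
* `Module.fittingIdeal_le_succ` — `Fitt_k(M) ⊆ Fitt_{k+1}(M)`; `Module.fittingIdeal_mono` —
  monotonicity in `k`.

## Sources

* D. Eisenbud, *Commutative Algebra with a View Toward Algebraic Geometry*, GTM 150 (1995),
  §20.2.
* The Stacks Project, Tag 07ZA (2).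
-/

namespace Literature.RingTheory.FittingIdeal

universe u v

variable {R : Type u} [CommRing R] {M : Type v} [AddCommGroup M] [Module R M]

/-- `Fitt_k(M) = R` as soon as `M` is generated by a family of `l ≤ k` elements: pad the family
with zeros to size `k`. [cite: Eisenbud1995, §20.2] -/
theorem Module.fittingIdeal_eq_top_of_span_eq_top_of_le {l k : ℕ} (hlk : l ≤ k) (x : Fin l → M)
    (hx : Submodule.span R (Set.range x) = ⊤) : Module.fittingIdeal R M k = ⊤ := by
  -- the padded family
  let x' : Fin k → M := fun i => if h : (i : ℕ) < l then x ⟨i, h⟩ else 0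
  refine Module.fittingIdeal_eq_top_of_span_eq_top x' (top_le_iff.mp ?_)
  rw [← hx]
  refine Submodule.span_mono ?_
  rintro _ ⟨i, rfl⟩
  refine ⟨⟨i, lt_of_lt_of_le i.2 hlk⟩, ?_⟩
  simp [x', i.2]

/-- **`Fitt_k(M) ⊆ Fitt_{k+1}(M)`** (Eisenbud §20.2; Stacks 07ZA (2)): expand a `j × j` minor of
relations among `j + k` generators along its first row (Laplace, `Matrix.det_succ_row_zero`);
the cofactors are `(j - 1) × (j - 1)` minors of relations among the same `(j - 1) + (k + 1)`
generators. (For `j = 0` the minor is `1` and `M` is generated by `k ≤ k + 1` elements.)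
[cite: Eisenbud1995, §20.2] -/
theorem Module.fittingIdeal_le_succ (k : ℕ) :
    Module.fittingIdeal R M k ≤ Module.fittingIdeal R M (k + 1) := by
  refine Ideal.span_le.mpr ?_
  rintro _ ⟨j, x, ρ, σ, hx, hρ, rfl⟩
  cases j with
  | zero =>
    -- no relation: the minor is `1`, and `M` is generated by `0 + k ≤ k + 1` elements
    rw [Matrix.det_isEmpty, SetLike.mem_coe,
      Module.fittingIdeal_eq_top_of_span_eq_top_of_le (by omega) x hx]
    trivial
  | succ j =>
    -- Laplace expansion along the first row
    rw [SetLike.mem_coe, Matrix.det_succ_row_zero]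
    refine Submodule.sum_mem _ fun c _ => Ideal.mul_mem_left _ _ ?_
    -- the cofactor is a `j × j` minor of relations among the same `j + (k + 1)` generators
    have hjk : j + 1 + k = j + (k + 1) := by omega
    let x' : Fin (j + (k + 1)) → M := fun i => x (i.cast hjk.symm)
    have hx' : Submodule.span R (Set.range x') = ⊤ := by
      have hr : Set.range x' = Set.range x := by
        ext m
        constructor
        · rintro ⟨i, rfl⟩
          exact ⟨i.cast hjk.symm, rfl⟩
        · rintro ⟨i, rfl⟩
          exact ⟨i.cast hjk, by simp [x']⟩
      rw [hr, hx]
    let ρ' : Fin j → Fin (j + (k + 1)) → R := fun i i' => ρ i.succ (i'.cast hjk.symm)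
    have hρ' : ∀ i, ∑ l, ρ' i l • x' l = 0 := by
      intro i
      have h := hρ i.succ
      rw [← h]
      exact Fintype.sum_equiv (finCongr hjk.symm) _ _ fun l => rfl
    let σ' : Fin j ↪ Fin (j + (k + 1)) :=
      ⟨fun i' => (σ (c.succAbove i')).cast hjk, fun a b hab => by
        have := Fin.cast_injective hjk hab
        exact Fin.succAbove_right_injective (σ.injective this)⟩
    have hmem := Module.det_mem_fittingIdeal (R := R) (M := M) x' hx' ρ' hρ' σ'
    convert hmem using 2
    ext i i'
    simp [ρ', σ', Matrix.submatrix_apply]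

/-- **Monotonicity of the Fitting ideals in the index**: `k ≤ k' → Fitt_k(M) ⊆ Fitt_{k'}(M)`.
[cite: Eisenbud1995, §20.2] -/
theorem Module.fittingIdeal_mono {k k' : ℕ} (h : k ≤ k') :
    Module.fittingIdeal R M k ≤ Module.fittingIdeal R M k' := by
  induction h with
  | refl => exact le_rfl
  | step _ ih => exact ih.trans (Module.fittingIdeal_le_succ _)

end Literature.RingTheory.FittingIdeal
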